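import Summits.QuantumFields.YangMills.Theorems.UnitScaleTiltHalvingCompetitorMapFramesSU2
import Summits.QuantumFields.YangMills.Theorems.UnitScaleTiltHalvingP1FlatCoreSupplierTowers
import HarnessLib

/-!
# `hP1room` PROGRAMME (LEAD-H «H = hSupU» BOARD v2, (S3); ★w3-20520 g6 (A-1) STAGE 2 letter table v1, row [R-g]): ★★ THE FRAME CONSTANT
# `C := (gs′ k y₀)⁻¹ ν k y₀` OF THE SUPPLIER DOOR IS SPECIAL UNITARY — the `hCsu` row of ✓`HalvingP1FlatCoreSupplierDoor.hSup_of_contentRows` from the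
# `SU(2)`-valuedness of the fine field and of the pre-gauge `g` plus near-flatness of the gauged field on the top block of `x₀`

Route `UnitScaleTilt`, crux K1 child «MinimiserStabilityRegPr» (stmt-QuantumFields-19200), registered stub `stub_halvingStep` (`BirthV10`), text
`H = hSupU ⟸ content rows` (✓p641613 ∘ ✓p638384; STAGE 2 `hSup_of_contentRows`).  Cell `ym3-torus` (HUMAN RULING D-0037: YM₃ on T³ is ladder rung R3 — NOT d = 4,
NOT a mass gap, NOT the Clay problem), width seat `ym-ust-19200-w8` gen 5 (★w3-20520 g6 14:54:03Z «w8-19200: hCsu — YES, YOURS»; shape adopted letter for letter: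
the near-flatness DISPLAYED on the top block, budget on `s₀`, not routed through the chart one-form).  `--supports stmt-QuantumFields-19200 --as helper`;
THEOREMS ONLY (0 `def`, 0 `sorry`); count-neutral; nothing here claims `hSupU`, `hP1room`, the stub, the crux, the rung or a mass gap.

WHY.  In the supplier door the `ℤ³` gauge `w` is DEFINED by the composite-gauge identity `hug` with the CONSTANT `C := (gs′ k y₀)⁻¹ · ν k y₀` (`k = K − n`,
`y₀ = Bᵏ x₀`): `gs′` is the pre-gauge `g` pulled back along the centre embeddings ((T2) ✓`HalvingP1FlatCoreSupplierTowers.exists_gsTower`: `gs′₀ = g`,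
`gs′_{i+1}(y) = gs′_i(emb y)`) and `ν` is the accumulated-frame tower of the gauged fine field `W₁ := (U♯)^g` ((T1) ✓`exists_nuTower`: `ν₀ = 1`,
`ν_{i+1}(y) = ν_i(emb y) · v(U̿^{(i)}W₁)(y)`).  The door needs `C ∈ SU(2)` (row `hCsu`) to conjugate N05's chart without leaving the group.  Each frame
`v(U̿^{(i)}W₁)(y)` is unitary with `det = 1` by ✓`HalvingCompetitorMapFramesSU2.su2_vframeU_dbarIterU` as soon as `W₁` is `SU(2)`-valued and `s₀`-near-flat on the
fine bonds under the block `y` with `8·3800·ℓ²·L^{i+1}·s₀ ≤ 1`; the blocks met by the recursion from `y₀` downwards are `y₀, emb y₀, emb (emb y₀), …`, whose fine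
territories are nested inside the top block `{s | Bᵏ s = y₀}` (✓`Site.blockOf_emb`: `B(emb y) = y`), so ONE near-flatness hypothesis on the top block and ONE budget at
the top level feed every frame; `gs′ k y₀` is a value of `g`; products and inverses stay in `SU(2)` (✓`su2_pred_one∕_mul∕_inv`).

WHAT IS PROVED (ns `…Theorems.HalvingP1FlatCoreSupplierFramesSU2`; `M₂(ℂ)ˣ`-valued fields, L²-operator norm).
* §1 (any `P : Params`) ★`su2_nuTower` — for a tower `ν` with the (T1) recursion over a fine field `W`, a fine set `T` on which `W` is `SU(2)`-valued and
  `s₀`-near-flat: `∀ k ≤ m_P + K_P`, budget `8·3800·((d+2)L)²·L^k·s₀ ≤ 1` ⇒ for every `k`-block `y` whose fine territory lies in `T`, `ν k y` is unitary with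
  `det = 1` (induction on `k`; territory nesting by ✓`Site.blockOf_emb`).
* §1 `exists_eq_gsTower` — `gs′ i y = g s` for some fine `s` ((T2) recursion); `su2_gsTower` — hence `SU(2)`-valued when `g` is.
* §2 (member `(F, n, K)`) ★★`hCsu_of_near` — THE DOOR's ROW VERBATIM:
  `↑((gs′ (K−n) (Bᵏx₀))⁻¹ * ν (K−n) (Bᵏx₀)) ∈ Matrix.specialUnitaryGroup (Fin 2) ℂ` from `hg : ∀ s, ↑(g s) ∈ SU(2)`, the (T1)∕(T2) recursions `hν0 hνs hg0 hgs`
  (✓p641699's letters), `hW1near : ∀ b, Bᵏ b₋ = Bᵏ x₀ → Bᵏ b₊ = Bᵏ x₀ → ‖↑((U♯)^g b) − 1‖ ≤ s₀` and the top-level budget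
  `8·3800·((d+2)L)²·L^{K−n}·s₀ ≤ 1`; ★`hCsu_of_near_eta` — the same with `s₀ := L^{−(K−n)}·c`, budget `8·3800·((d+2)L)²·c ≤ 1` (`k`-FREE: the frame budget's
  `L^k` cancels against `η = L^{−k}`).
HONEST SCOPE: bookkeeping over landed letters (the per-frame row is ★w1-19200 g7's ✓`su2_vframeU_dbarIterU` over ★w8 s2's ✓`ChartDoubleBarSU2.pred_dbarIterU_of_reads`); the
near-flatness `hW1near` of the pre-gauged field on the top block is the J3 pre-gauge hand's output and is NOT proved here; nothing of print is asserted; NOT a claim about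
`hSupU`, the stub, the crux, the rung or a mass gap.

References: T. Bałaban, CMP **98** (1985) 17–51 [Balaban1985Averaging] ((8) p.19, (19)–(23) p.21, (92) p.31, (110) p.34, (122)–(123) p.36); CMP **109** (1987)
249–301 [Balaban1987RG1] ((0.3)–(0.9) pp.252–253); CMP **99** (1985) 75–102 [Balaban1985RegularSpaces] ((1.91) p.98).
-/

set_option autoImplicit false

noncomputable section

open scoped BigOperators Matrix.Norms.L2Operator

namespace Summit.QuantumFields.YangMills.Theorems.HalvingP1FlatCoreSupplierFramesSU2

open Literature.MathematicalPhysics.QuantumFieldTheory.Balaban1983to89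
open Literature.MathematicalPhysics.QuantumFieldTheory.Balaban1983to89.T3ContinuumYM3Torus
open T4Continuum BlockAveraging
open B5Eq118OneStroke (iterBlockOf iterBlockOf_succ iterBlockOf_zero)
open B10Eq27TorusAxialLog (unitsField toUField suIncl val_suIncl val_unitsField gaugeActT gaugeActT_apply)
open Summit.QuantumFields.YangMills.Theorems.Prop8ChartDoubleBar (dbarIterU vframeU)
open HalvingCompetitorMapFramesSU2 (su2_vframeU_dbarIterU su2_pred_one su2_pred_mul su2_pred_inv)

/-! ## §1 The two towers stay in `SU(2)` (any `P : Params`) -/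

section Towers

variable {P : Params}

/-- ★ **THE ACCUMULATED-FRAME TOWER IS `SU(2)`-VALUED ABOVE A SMALL `SU(2)` TERRITORY.**  Let `ν₀ = 1`, `ν_{i+1}(y) = ν_i(emb y)·v(U̿^{(i)}W)(y)` and let `W` be
unitary with `det = 1` and `s₀`-near-flat on the fine bonds with both ends in `T`.  Then for every level `k ≤ m_P + K_P` with `8·3800·((d+2)L)²·L^k·s₀ ≤ 1` and every
`k`-block `y` whose fine territory `{s | Bᵏ s = y}` lies in `T`, the matrix `ν k y` is unitary with `det = 1`.  Induction on `k`: the factor `ν_k(emb y)` sits over the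
territory of `emb y`, which is inside that of `y` (`B(emb y) = y`, ✓`Site.blockOf_emb`), and the budget descends (`L^k ≤ L^{k+1}`); the frame factor is
✓`HalvingCompetitorMapFramesSU2.su2_vframeU_dbarIterU`. [cite: Balaban1985Averaging, (110) p.34, (92) p.31; Balaban1987RG1, (0.3) p.252, (0.9) p.253] -/
theorem su2_nuTower (W : GaugeField P 0 (Matrix (Fin 2) (Fin 2) ℂ)ˣ) (ν : (i : ℕ) → Site P i → (Matrix (Fin 2) (Fin 2) ℂ)ˣ) (hν0 : ∀ s, ν 0 s = 1)
    (hνs : ∀ (i : ℕ) (y : Site P (i + 1)), ν (i + 1) y = ν i (emb y) * vframeU (dbarIterU i W) y)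
    (T : Set (Site P 0)) {s₀ : ℝ} (hs₀ : 0 ≤ s₀)
    (hU : ∀ b : PBond P 0, b.src ∈ T → b.tgt ∈ T → ‖((W b : (Matrix (Fin 2) (Fin 2) ℂ)ˣ) : Matrix (Fin 2) (Fin 2) ℂ) - 1‖ ≤ s₀)
    (hsu : ∀ b : PBond P 0, b.src ∈ T → b.tgt ∈ T →
      ((W b : (Matrix (Fin 2) (Fin 2) ℂ)ˣ) : Matrix (Fin 2) (Fin 2) ℂ) ∈ Matrix.unitaryGroup (Fin 2) ℂ ∧ ((W b : (Matrix (Fin 2) (Fin 2) ℂ)ˣ) : Matrix (Fin 2) (Fin 2) ℂ).det = 1) :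
    ∀ k : ℕ, k ≤ P.m + P.K → 8 * 3800 * (((P.d + 2) * P.L : ℕ) : ℝ) ^ 2 * (P.L : ℝ) ^ k * s₀ ≤ 1 →
      ∀ y : Site P k, (∀ s : Site P 0, iterBlockOf k s = y → s ∈ T) →
        ((ν k y : (Matrix (Fin 2) (Fin 2) ℂ)ˣ) : Matrix (Fin 2) (Fin 2) ℂ) ∈ Matrix.unitaryGroup (Fin 2) ℂ ∧
          ((ν k y : (Matrix (Fin 2) (Fin 2) ℂ)ˣ) : Matrix (Fin 2) (Fin 2) ℂ).det = 1 := by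
  intro k
  induction k with
  | zero =>
    intro _ _ y _
    rw [hν0 y]
    exact su2_pred_one
  | succ k ih =>
    intro hk hbudget y hT
    have hk' : k ≤ P.m + P.K := by omega
    have hL1 : (1 : ℝ) ≤ (P.L : ℝ) := by have := P.hL.2; exact_mod_cast this.le
    have hbudget' : 8 * 3800 * (((P.d + 2) * P.L : ℕ) : ℝ) ^ 2 * (P.L : ℝ) ^ k * s₀ ≤ 1 := by
      refine le_trans ?_ hbudget
      have hpow : (P.L : ℝ) ^ k ≤ (P.L : ℝ) ^ (k + 1) := pow_le_pow_right₀ hL1 (Nat.le_succ k)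
      have hc : (0 : ℝ) ≤ 8 * 3800 * (((P.d + 2) * P.L : ℕ) : ℝ) ^ 2 := by positivity
      exact mul_le_mul_of_nonneg_right (mul_le_mul_of_nonneg_left hpow hc) hs₀
    -- the territory of `emb y` lies inside that of `y`
    have hTemb : ∀ s : Site P 0, iterBlockOf k s = emb y → s ∈ T := by
      intro s hs
      refine hT s ?_
      rw [iterBlockOf_succ, hs, Site.blockOf_emb hk]
    have h1 := ih hk' hbudget' (emb y) hTemb
    -- the frame factor
    have h2 : ((vframeU (dbarIterU k W) y : (Matrix (Fin 2) (Fin 2) ℂ)ˣ) : Matrix (Fin 2) (Fin 2) ℂ) ∈ Matrix.unitaryGroup (Fin 2) ℂ ∧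
        ((vframeU (dbarIterU k W) y : (Matrix (Fin 2) (Fin 2) ℂ)ˣ) : Matrix (Fin 2) (Fin 2) ℂ).det = 1 :=
      su2_vframeU_dbarIterU hk y W hs₀ hbudget (fun b hs ht => hU b (hT _ hs) (hT _ ht)) (fun b hs ht => hsu b (hT _ hs) (hT _ ht))
    rw [hνs k y]
    exact su2_pred_mul _ _ h1 h2

/-- **THE PULLED-BACK PRE-GAUGE TAKES VALUES OF `g`**: with `gs′₀ = g`, `gs′_{i+1}(y) = gs′_i(emb y)`, every `gs′ i y` equals `g s` for some fine site `s` (namely the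
iterated centre). [cite: Balaban1985Averaging, (8) p.19, (92) p.31] -/
theorem exists_eq_gsTower {G : Type*} (g : GaugeTransf P 0 G) (gs' : (i : ℕ) → GaugeTransf P i G) (hg0 : gs' 0 = g)
    (hgs : ∀ (i : ℕ) (y : Site P (i + 1)), gs' (i + 1) y = gs' i (emb y)) :
    ∀ (i : ℕ) (y : Site P i), ∃ s : Site P 0, gs' i y = g s := by
  intro i
  induction i with
  | zero => intro y; exact ⟨y, by rw [hg0]⟩
  | succ i ih =>
    intro y
    obtain ⟨s, hs⟩ := ih (emb y)
    exact ⟨s, by rw [hgs, hs]⟩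

/-- **THE PULLED-BACK PRE-GAUGE IS `SU(2)`-VALUED** when `g` is. [cite: Balaban1985Averaging, (8) p.19, (19)-(23) p.21] -/
theorem su2_gsTower (g : GaugeTransf P 0 (Matrix (Fin 2) (Fin 2) ℂ)ˣ)
    (hg : ∀ s : Site P 0, ((g s : (Matrix (Fin 2) (Fin 2) ℂ)ˣ) : Matrix (Fin 2) (Fin 2) ℂ) ∈ Matrix.specialUnitaryGroup (Fin 2) ℂ)
    (gs' : (i : ℕ) → GaugeTransf P i (Matrix (Fin 2) (Fin 2) ℂ)ˣ) (hg0 : gs' 0 = g)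
    (hgs : ∀ (i : ℕ) (y : Site P (i + 1)), gs' (i + 1) y = gs' i (emb y)) (i : ℕ) (y : Site P i) :
    ((gs' i y : (Matrix (Fin 2) (Fin 2) ℂ)ˣ) : Matrix (Fin 2) (Fin 2) ℂ) ∈ Matrix.specialUnitaryGroup (Fin 2) ℂ := by
  obtain ⟨s, hs⟩ := exists_eq_gsTower g gs' hg0 hgs i y
  rw [hs]
  exact hg s

end Towers

/-! ## §2 ★★ The door's `hCsu` row -/

section Door

variable {F : T3Family} {n K : ℕ}

/-- ★★ **THE FRAME CONSTANT `C := (gs′ k y₀)⁻¹ · ν k y₀` OF THE SUPPLIER DOOR IS SPECIAL UNITARY** — the `hCsu` row of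
✓`HalvingP1FlatCoreSupplierDoor.hSup_of_contentRows` VERBATIM (`k = K − n`, `y₀ = Bᵏ x₀`), from: the fine field `U` is `SU(2)`-valued (by type), the pre-gauge `g` is
`SU(2)`-valued (`hg`), the towers `ν`, `gs′` obey the (T1)∕(T2) recursions (✓p641699's `hν0 hνs hg0 hgs`), and the gauged field `W₁ = (U♯)^g` is `s₀`-near-flat on the fine
bonds of the top block of `x₀` (`hW1near`, the J3 pre-gauge hand's row) with the top-level budget `8·3800·((d+2)L)²·L^{K−n}·s₀ ≤ 1`.
[cite: Balaban1985Averaging, (8) p.19, (19)-(23) p.21, (110) p.34; Balaban1987RG1, (0.9) p.253; Balaban1985RegularSpaces, (1.91) p.98] -/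
theorem hCsu_of_near (x₀ : Site (F.P K) 0) (U : GaugeField (F.P K) 0 (Matrix.specialUnitaryGroup (Fin 2) ℂ))
    (g : GaugeTransf (F.P K) 0 (Matrix (Fin 2) (Fin 2) ℂ)ˣ)
    (hg : ∀ s : Site (F.P K) 0, ((g s : (Matrix (Fin 2) (Fin 2) ℂ)ˣ) : Matrix (Fin 2) (Fin 2) ℂ) ∈ Matrix.specialUnitaryGroup (Fin 2) ℂ)
    (ν : (i : ℕ) → Site (F.P K) i → (Matrix (Fin 2) (Fin 2) ℂ)ˣ) (hν0 : ∀ s, ν 0 s = 1)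
    (hνs : ∀ (i : ℕ) (y : Site (F.P K) (i + 1)), ν (i + 1) y = ν i (emb y) * vframeU (dbarIterU i (gaugeActT g (unitsField (toUField U)))) y)
    (gs' : (i : ℕ) → GaugeTransf (F.P K) i (Matrix (Fin 2) (Fin 2) ℂ)ˣ) (hg0 : gs' 0 = g)
    (hgs : ∀ (i : ℕ) (y : Site (F.P K) (i + 1)), gs' (i + 1) y = gs' i (emb y))
    {s₀ : ℝ} (hs₀ : 0 ≤ s₀) (hbudget : 8 * 3800 * ((((F.P K).d + 2) * (F.P K).L : ℕ) : ℝ) ^ 2 * ((F.P K).L : ℝ) ^ (K - n) * s₀ ≤ 1)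
    (hW1near : ∀ b : PBond (F.P K) 0, iterBlockOf (K - n) b.src = iterBlockOf (K - n) x₀ → iterBlockOf (K - n) b.tgt = iterBlockOf (K - n) x₀ →
      ‖((gaugeActT g (unitsField (toUField U)) b : (Matrix (Fin 2) (Fin 2) ℂ)ˣ) : Matrix (Fin 2) (Fin 2) ℂ) - 1‖ ≤ s₀) :
    (((gs' (K - n) (iterBlockOf (K - n) x₀))⁻¹ * ν (K - n) (iterBlockOf (K - n) x₀) : (Matrix (Fin 2) (Fin 2) ℂ)ˣ) : Matrix (Fin 2) (Fin 2) ℂ) ∈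
      Matrix.specialUnitaryGroup (Fin 2) ℂ := by
  have hk : K - n ≤ (F.P K).m + (F.P K).K := FlatMinimizerH.le_T3 F n K
  -- the `SU(2)` predicate on the units of `M₂(ℂ)`, read from `specialUnitaryGroup` membership
  have hg' : ∀ s : Site (F.P K) 0, ((g s : (Matrix (Fin 2) (Fin 2) ℂ)ˣ) : Matrix (Fin 2) (Fin 2) ℂ) ∈ Matrix.unitaryGroup (Fin 2) ℂ ∧
      ((g s : (Matrix (Fin 2) (Fin 2) ℂ)ˣ) : Matrix (Fin 2) (Fin 2) ℂ).det = 1 := fun s => Matrix.mem_specialUnitaryGroup_iff.1 (hg s)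
  -- the gauged fine field is `SU(2)`-valued
  have hsu : ∀ b : PBond (F.P K) 0,
      ((gaugeActT g (unitsField (toUField U)) b : (Matrix (Fin 2) (Fin 2) ℂ)ˣ) : Matrix (Fin 2) (Fin 2) ℂ) ∈ Matrix.unitaryGroup (Fin 2) ℂ ∧
        ((gaugeActT g (unitsField (toUField U)) b : (Matrix (Fin 2) (Fin 2) ℂ)ˣ) : Matrix (Fin 2) (Fin 2) ℂ).det = 1 := by
    intro b
    have hUb : ((unitsField (toUField U) b : (Matrix (Fin 2) (Fin 2) ℂ)ˣ) : Matrix (Fin 2) (Fin 2) ℂ) ∈ Matrix.unitaryGroup (Fin 2) ℂ ∧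
        ((unitsField (toUField U) b : (Matrix (Fin 2) (Fin 2) ℂ)ˣ) : Matrix (Fin 2) (Fin 2) ℂ).det = 1 := by
      have hval : ((unitsField (toUField U) b : (Matrix (Fin 2) (Fin 2) ℂ)ˣ) : Matrix (Fin 2) (Fin 2) ℂ) = ((U b : Matrix.specialUnitaryGroup (Fin 2) ℂ) : _) := rfl
      rw [hval]
      exact Matrix.mem_specialUnitaryGroup_iff.1 (U b).2
    rw [gaugeActT_apply]
    exact su2_pred_mul _ _ (su2_pred_mul _ _ (hg' b.src) hUb) (su2_pred_inv _ (hg' b.tgt))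
  -- the accumulated frame at the top block
  have hν := su2_nuTower (gaugeActT g (unitsField (toUField U))) ν hν0 hνs {s | iterBlockOf (K - n) s = iterBlockOf (K - n) x₀} hs₀
    (fun b hs ht => hW1near b hs ht) (fun b _ _ => hsu b) (K - n) hk hbudget (iterBlockOf (K - n) x₀) (fun s hs => hs)
  -- the pulled-back pre-gauge at the top block
  have hgs' := Matrix.mem_specialUnitaryGroup_iff.1 (su2_gsTower g hg gs' hg0 hgs (K - n) (iterBlockOf (K - n) x₀))
  exact Matrix.mem_specialUnitaryGroup_iff.2 (su2_pred_mul _ _ (su2_pred_inv _ hgs') hν)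

/-- ★ **THE SAME ROW WITH THE `k`-FREE BUDGET**: near-flatness `‖↑((U♯)^g b) − 1‖ ≤ L^{−(K−n)}·c` on the top block of `x₀` with `8·3800·((d+2)L)²·c ≤ 1` (the frame
budget's `L^{K−n}` cancels against `η = L^{−(K−n)}`; `c` is the size of `η⁻¹·log (U♯)^g`, e.g. a (1.36)-type bound of the pre-gauged chart).
[cite: Balaban1985RegularSpaces, (1.36) p.82, (1.91) p.98; Balaban1985Averaging, (110) p.34; Balaban1987RG1, (0.9) p.253] -/
theorem hCsu_of_near_eta (x₀ : Site (F.P K) 0) (U : GaugeField (F.P K) 0 (Matrix.specialUnitaryGroup (Fin 2) ℂ))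
    (g : GaugeTransf (F.P K) 0 (Matrix (Fin 2) (Fin 2) ℂ)ˣ)
    (hg : ∀ s : Site (F.P K) 0, ((g s : (Matrix (Fin 2) (Fin 2) ℂ)ˣ) : Matrix (Fin 2) (Fin 2) ℂ) ∈ Matrix.specialUnitaryGroup (Fin 2) ℂ)
    (ν : (i : ℕ) → Site (F.P K) i → (Matrix (Fin 2) (Fin 2) ℂ)ˣ) (hν0 : ∀ s, ν 0 s = 1)
    (hνs : ∀ (i : ℕ) (y : Site (F.P K) (i + 1)), ν (i + 1) y = ν i (emb y) * vframeU (dbarIterU i (gaugeActT g (unitsField (toUField U)))) y)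
    (gs' : (i : ℕ) → GaugeTransf (F.P K) i (Matrix (Fin 2) (Fin 2) ℂ)ˣ) (hg0 : gs' 0 = g)
    (hgs : ∀ (i : ℕ) (y : Site (F.P K) (i + 1)), gs' (i + 1) y = gs' i (emb y))
    {c : ℝ} (hc : 0 ≤ c) (hbudget : 8 * 3800 * ((((F.P K).d + 2) * (F.P K).L : ℕ) : ℝ) ^ 2 * c ≤ 1)
    (hW1near : ∀ b : PBond (F.P K) 0, iterBlockOf (K - n) b.src = iterBlockOf (K - n) x₀ → iterBlockOf (K - n) b.tgt = iterBlockOf (K - n) x₀ →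
      ‖((gaugeActT g (unitsField (toUField U)) b : (Matrix (Fin 2) (Fin 2) ℂ)ˣ) : Matrix (Fin 2) (Fin 2) ℂ) - 1‖ ≤ ((F.L : ℝ)⁻¹) ^ (K - n) * c) :
    (((gs' (K - n) (iterBlockOf (K - n) x₀))⁻¹ * ν (K - n) (iterBlockOf (K - n) x₀) : (Matrix (Fin 2) (Fin 2) ℂ)ˣ) : Matrix (Fin 2) (Fin 2) ℂ) ∈
      Matrix.specialUnitaryGroup (Fin 2) ℂ := by
  have hLF : ((F.P K).L : ℝ) = (F.L : ℝ) := by norm_cast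
  have hL0 : (0 : ℝ) < (F.L : ℝ) := by have := F.hL.2; exact_mod_cast (by omega : 0 < F.L)
  have hη0 : (0 : ℝ) ≤ ((F.L : ℝ)⁻¹) ^ (K - n) := pow_nonneg (inv_nonneg.2 hL0.le) _
  refine hCsu_of_near x₀ U g hg ν hν0 hνs gs' hg0 hgs (mul_nonneg hη0 hc) ?_ hW1near
  have hcancel : ((F.P K).L : ℝ) ^ (K - n) * (((F.L : ℝ)⁻¹) ^ (K - n) * c) = c := by
    rw [hLF, ← mul_assoc, ← mul_pow, mul_inv_cancel₀ hL0.ne', one_pow, one_mul]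
  calc 8 * 3800 * ((((F.P K).d + 2) * (F.P K).L : ℕ) : ℝ) ^ 2 * ((F.P K).L : ℝ) ^ (K - n) * (((F.L : ℝ)⁻¹) ^ (K - n) * c)
      = 8 * 3800 * ((((F.P K).d + 2) * (F.P K).L : ℕ) : ℝ) ^ 2 * (((F.P K).L : ℝ) ^ (K - n) * (((F.L : ℝ)⁻¹) ^ (K - n) * c)) := by ring
    _ = 8 * 3800 * ((((F.P K).d + 2) * (F.P K).L : ℕ) : ℝ) ^ 2 * c := by rw [hcancel]
    _ ≤ 1 := hbudget

end Door

end Summit.QuantumFields.YangMills.Theorems.HalvingP1FlatCoreSupplierFramesSU2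

end
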